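import Summits.KontsevichZagierPeriods.KontsevichZagierPeriods.Theses.LinkTwistWrithe
import Summits.KontsevichZagierPeriods.KontsevichZagierPeriods.Theorems.InverseLandauTateLiftingThreeSphereVolume

/-!
# `ThreeSphereVolume` (stmt-KontsevichZagierPeriods-4308, route LinkTwistWrithe) — proof

The support item `ThreeSphereVolume` of route LinkTwistWrithe — `vol S³ = 2π²` INSIDE THE RULES: the round
volume density of `S³` in the stereographic chart, `[ℝ³, 8/(1+|x|²)³]`, minus twice the product of two
open unit discs, `2·[{w₀²+w₁² < 1 ∧ w₂²+w₃² < 1} ⊆ ℝ⁴, 1]`, lies in `KZ.relations` — is verbatim the landed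
stub `Summit.KontsevichZagierPeriods.InverseLandau.tateLifting_threeSphereVolume` of line `Sketch` of the
crux `TateLifting` (route InverseLandau, lead c10): rotation reduction, one scaling change of variables of
the upper half-plane, product splitting, the dimension-`≤ 1` algebraic sector and the formal period ring.
-/

namespace Summit.KontsevichZagierPeriods.LinkTwistWrithe

/-- **`ThreeSphereVolume`** (route LinkTwistWrithe, stmt-KontsevichZagierPeriods-4308): for every
`r = [ℝ³, 8/(1+|x|²)³]` and every `r' = [D × D, 1]` (`D` the open unit disc),
`[r] − 2·[r'] ∈ KZ.relations`. Proof: `InverseLandau.tateLifting_threeSphereVolume`.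
[cite: KontsevichZagier2001, §1.2] -/
theorem threeSphereVolume_proof :
    Summit.KontsevichZagierPeriods.KontsevichZagierPeriods.Theses.LinkTwistWrithe.ThreeSphereVolume :=
  Summit.KontsevichZagierPeriods.InverseLandau.tateLifting_threeSphereVolume

end Summit.KontsevichZagierPeriods.LinkTwistWrithe
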